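import Literature.AnabelianGeometry.SemiGraphs.ProSigmaCompletionSemidirectRetraction
import HarnessLib

/-!
# Pro-`Σ` completion of `Δ ⋊_φ ℤ`, XI: twisted sections `inl δ · inr 1` against the completed section

[SemiAnbd] Ex. 2.10 p. 31 (bib `MochizukiSemiAnbd2006`); [AbsTopII] Def 1.2 (ii) p. 10, Prop 1.3 (ii)–(iv)
pp. 11–12 (bib `MochizukiAbsTopII2013`; kurims manuscript `paper:url-585b8d0ad0d9`): at a node joining two
vertices `v, v′` of a stable log curve the two vertex inertia groups `I_v, I_{v′} ≅ Ẑ^Σ` sit in `I_e ≅ Ẑ^Σ × Ẑ^Σ`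
and «`I_v ∩ I_{v′} = {1}`» — at the constructed Dehn-twist models `I_v` is the completed section
`T = closure ι(inr ℤ)` and `I_{v′}` a TWISTED section `U = closure ι⟨inl δ · inr 1⟩`.

PROOF-ONLY file (abc-iut-f-066 gen 5, row «P13-TWO-VERTEX-NODAL-MODEL»; part XI of the `IsProSigmaCompletion`
series, over part X `ProSigmaCompletionSemidirectRetraction.lean`).  Setting: `ι : Δ ⋊_φ ℤ → P` a pro-`Σ`
completion with profinite `P`, `A := closure ι(inl Δ)`, `T := closure ι(inr ℤ)`, `U := closure ι⟨inl δ · inr 1⟩`.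

* `closure_zpowers_twisted_sup_closure_inl_eq_top` — `U · A = P`;
* `eq_closure_zpowers_of_le_of_inf_eq_bot` — a subgroup `S ⊇ U` with `S ∩ A = {1}` IS `U` (the retraction maps
  `U` onto `T`);
* `centralizes_of_fixed` / `centralizes_twisted_of_conj` — `T` centralises `ι(inl d)` when `φ(1) d = d`; `U`
  centralises `ι(inl d)` when `φ(1) d = δ⁻¹ d δ`;
* `closure_inr_inf_conj_closure_zpowers_eq_bot` — **given a `φ`-invariant character `f : Δ → ℤ` with
  `f δ = −1`: `T ∩ γ U γ⁻¹ = {1}` and `U ∩ γ T γ⁻¹ = {1}` for EVERY `γ ∈ P`** (the continuous extension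
  `G : P → T` of `inl d ↦ f d`, `inr n ↦ n` kills `U` and — `T` being abelian — all its conjugates, while
  `G|_T = id`).

Classical profinite group theory; no side taken on [IUTchIII] Cor 3.12.
-/

namespace Literature.AnabelianGeometry.SemiGraphs.SemiGraphOfAnabelioids.IsProSigmaCompletion

open Literature.AnabelianGeometry.Anabelioids (IsSigmaInteger)
open Literature.AnabelianGeometry.AbsoluteAnabelian (AbsTopII.IsFreeProSigmaCyclic)
open Topology
open scoped Pointwise

namespace SemidirectCofinal

variable {Δ : Type*} [Group Δ] {Sigma : Set ℕ} (φ : Multiplicative ℤ →* MulAut Δ)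
variable {P : Type*} [Group P] [TopologicalSpace P] [IsTopologicalGroup P] [CompactSpace P] [T2Space P]
  [TotallyDisconnectedSpace P]

/-! ### Twisted sections `u = inl δ · inr 1` -/

omit [TotallyDisconnectedSpace P] in
/-- For `u := inl δ · inr 1`, **`closure ι⟨u⟩ · A = P`** (`ι(inr 1) = ι(inl δ)⁻¹ ι(u)`, and the product of the
closed normal `A` with a compact subgroup is closed). [cite: MochizukiAbsTopII2013, Prop 1.3 (iii) p.11] -/
theorem closure_zpowers_twisted_sup_closure_inl_eq_top {ι : (Δ ⋊[φ] Multiplicative ℤ) →* P}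
    (hι : IsProSigmaCompletion Sigma ι) (δ : Δ) :
    (Subgroup.zpowers (ι (SemidirectProduct.inl δ * SemidirectProduct.inr (Multiplicative.ofAdd (1 : ℤ))))).topologicalClosure ⊔
      ((SemidirectProduct.inl : Δ →* Δ ⋊[φ] Multiplicative ℤ).range.map ι).topologicalClosure = ⊤ := by
  set A := ((SemidirectProduct.inl : Δ →* Δ ⋊[φ] Multiplicative ℤ).range.map ι).topologicalClosure with hA
  set U := (Subgroup.zpowers (ι (SemidirectProduct.inl δ * SemidirectProduct.inr (Multiplicative.ofAdd (1 : ℤ))))).topologicalClosure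
    with hU
  haveI : A.Normal := normal_closure_map_range_inl φ hι.dense
  have hclosed : IsClosed ((U ⊔ A : Subgroup P) : Set P) := by
    rw [Subgroup.mul_normal]
    exact ((Subgroup.isClosed_topologicalClosure _).isCompact.mul
      (Subgroup.isClosed_topologicalClosure _).isCompact).isClosed
  have hinl : ∀ d : Δ, ι (SemidirectProduct.inl d) ∈ U ⊔ A := fun d =>
    Subgroup.mem_sup_right (Subgroup.le_topologicalClosure _ ⟨_, ⟨d, rfl⟩, rfl⟩)
  have hinr1 : ι (SemidirectProduct.inr (Multiplicative.ofAdd (1 : ℤ))) ∈ U ⊔ A := by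
    have hu : ι (SemidirectProduct.inl δ * SemidirectProduct.inr (Multiplicative.ofAdd (1 : ℤ))) ∈ U ⊔ A :=
      Subgroup.mem_sup_left (Subgroup.le_topologicalClosure _ (Subgroup.mem_zpowers _))
    have := (U ⊔ A).mul_mem ((U ⊔ A).inv_mem (hinl δ)) hu
    rwa [map_mul, inv_mul_cancel_left] at this
  have hinr : ∀ n : Multiplicative ℤ, ι (SemidirectProduct.inr n) ∈ U ⊔ A := fun n => by
    have : SemidirectProduct.inr (G := Multiplicative ℤ) (N := Δ) (φ := φ) n =
        (SemidirectProduct.inr (Multiplicative.ofAdd (1 : ℤ))) ^ (Multiplicative.toAdd n) := by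
      rw [← map_zpow, ← ofAdd_zsmul, smul_eq_mul, mul_one, ofAdd_toAdd]
    rw [this, map_zpow]
    exact (U ⊔ A).zpow_mem hinr1 _
  have hrange : Set.range ι ⊆ ((U ⊔ A : Subgroup P) : Set P) := by
    rintro _ ⟨g, rfl⟩
    rw [← SemidirectProduct.inl_left_mul_inr_right g, map_mul]
    exact (U ⊔ A).mul_mem (hinl _) (hinr _)
  rw [eq_top_iff]
  intro p _
  have hp : p ∈ closure (Set.range ι) := hι.dense.closure_eq ▸ Set.mem_univ p
  exact (hclosed.closure_subset_iff.mpr hrange) hp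

/-- **Uniqueness of the twisted section among complements**: if `S ≥ U = closure ι⟨inl δ · inr 1⟩` and
`S ∩ A = {1}`, then `S = U` — every `s ∈ S` has the same retraction as some `u ∈ U` (`F(U) = T` by density and
compactness), so `s u⁻¹ ∈ S ∩ Ker F = S ∩ A = {1}` («`I_v`» is recovered from one section it contains).
[cite: MochizukiAbsTopII2013, Prop 1.3 (iii) p.11] -/
theorem eq_closure_zpowers_of_le_of_inf_eq_bot {ι : (Δ ⋊[φ] Multiplicative ℤ) →* P}
    (hι : IsProSigmaCompletion Sigma ι) (δ : Δ) {S : Subgroup P}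
    (hUS : (Subgroup.zpowers (ι (SemidirectProduct.inl δ *
      SemidirectProduct.inr (Multiplicative.ofAdd (1 : ℤ))))).topologicalClosure ≤ S)
    (hinf : S ⊓ ((SemidirectProduct.inl : Δ →* Δ ⋊[φ] Multiplicative ℤ).range.map ι).topologicalClosure = ⊥) :
    S = (Subgroup.zpowers (ι (SemidirectProduct.inl δ *
      SemidirectProduct.inr (Multiplicative.ofAdd (1 : ℤ))))).topologicalClosure := by
  set U := (Subgroup.zpowers (ι (SemidirectProduct.inl δ * SemidirectProduct.inr (Multiplicative.ofAdd (1 : ℤ))))).topologicalClosure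
    with hU
  set T := ((SemidirectProduct.inr : Multiplicative ℤ →* Δ ⋊[φ] Multiplicative ℤ).range.map ι).topologicalClosure
    with hT
  obtain ⟨F, hFc, hFι, hFT, hFA⟩ := exists_retraction φ hι
  refine le_antisymm (fun s hs => ?_) hUS
  -- `F(U) = T`: compact image containing the dense `ι(inr ℤ)`
  have hFU : ∀ t : T, ∃ u ∈ U, F u = t := by
    have himage : IsClosed (F '' (U : Set P)) :=
      ((Subgroup.isClosed_topologicalClosure _).isCompact.image hFc).isClosed
    have hsub : Set.range (fun n : Multiplicative ℤ => (⟨ι (SemidirectProduct.inr n),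
        Subgroup.le_topologicalClosure _ ⟨_, ⟨n, rfl⟩, rfl⟩⟩ : T)) ⊆ F '' (U : Set P) := by
      rintro _ ⟨n, rfl⟩
      refine ⟨(ι (SemidirectProduct.inl δ * SemidirectProduct.inr (Multiplicative.ofAdd (1 : ℤ)))) ^ (Multiplicative.toAdd n),
        U.zpow_mem (Subgroup.le_topologicalClosure _ (Subgroup.mem_zpowers _)) _, Subtype.ext ?_⟩
      rw [← map_zpow, hFι, map_zpow, map_mul, SemidirectProduct.rightHom_inl, SemidirectProduct.rightHom_inr,
        one_mul, ← ofAdd_zsmul, smul_eq_mul, mul_one, ofAdd_toAdd]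
    have hdense : Dense (Set.range (fun n : Multiplicative ℤ => (⟨ι (SemidirectProduct.inr n),
        Subgroup.le_topologicalClosure _ ⟨_, ⟨n, rfl⟩, rfl⟩⟩ : T))) := by
      have hd := (isProSigmaCompletion_closure_inr φ hι).dense
      refine hd.mono ?_
      rintro _ ⟨n, rfl⟩
      exact ⟨n, rfl⟩
    intro t
    have ht : t ∈ F '' (U : Set P) := by
      have := hdense.mono hsub
      rw [dense_iff_closure_eq, himage.closure_eq] at this
      exact this ▸ Set.mem_univ t
    obtain ⟨u, hu, hut⟩ := ht
    exact ⟨u, hu, hut⟩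
  obtain ⟨u, hu, hut⟩ := hFU (F s)
  have h1 : F (s * u⁻¹) = 1 := by rw [map_mul, map_inv, hut, mul_inv_cancel]
  have hmem := (retraction_eq_one_iff φ hι hFT hFA _).mp h1
  have hS : s * u⁻¹ ∈ S := S.mul_mem hs (S.inv_mem (hUS hu))
  have : s * u⁻¹ = 1 := by rw [← Subgroup.mem_bot, ← hinf]; exact ⟨hS, hmem⟩
  rw [mul_inv_eq_one] at this
  rw [this]
  exact hu

/-! ### What the section and the twisted sections centralise -/

/-- If `φ(1)` fixes `d`, then every `φ(g)` fixes `d`. [cite: MochizukiAbsTopII2013, Def 1.2 (ii) p.10] -/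
theorem apply_eq_self_of_apply_one_eq_self {d : Δ} (hd : φ (Multiplicative.ofAdd (1 : ℤ)) d = d)
    (g : Multiplicative ℤ) : φ g d = d := by
  let S : Subgroup (Multiplicative ℤ) :=
    { carrier := {g | φ g d = d}
      one_mem' := by simp
      mul_mem' := fun {a b} ha hb => by
        change φ (a * b) d = d
        rw [map_mul, MulAut.mul_apply, hb, ha]
      inv_mem' := fun {a} ha => by
        change φ a⁻¹ d = d
        conv_lhs => rw [← ha]
        rw [map_inv, MulAut.inv_apply_self] }
  have hle : Subgroup.zpowers (Multiplicative.ofAdd (1 : ℤ)) ≤ S := (Subgroup.zpowers_le).mpr hd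
  have hg : g ∈ Subgroup.zpowers (Multiplicative.ofAdd (1 : ℤ)) :=
    ⟨Multiplicative.toAdd g, by
      change Multiplicative.ofAdd (1 : ℤ) ^ Multiplicative.toAdd g = g
      rw [← ofAdd_zsmul, smul_eq_mul, mul_one, ofAdd_toAdd]⟩
  exact hle hg

omit [CompactSpace P] [TotallyDisconnectedSpace P] in
/-- **`T` centralises the fixed letters**: if `φ(1) d = d` then every element of `T = closure ι(inr ℤ)` commutes
with `ι(inl d)` (`inr g · inl d · inr g⁻¹ = inl (φ g d)`; centralisers are closed).
[cite: MochizukiAbsTopII2013, Prop 1.3 (iii) p.11] -/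
theorem centralizes_of_fixed (ι : (Δ ⋊[φ] Multiplicative ℤ) →* P) {d : Δ} (hd : φ (Multiplicative.ofAdd (1 : ℤ)) d = d)
    {t : P} (ht : t ∈ ((SemidirectProduct.inr :
      Multiplicative ℤ →* Δ ⋊[φ] Multiplicative ℤ).range.map ι).topologicalClosure) :
    t * ι (SemidirectProduct.inl d) = ι (SemidirectProduct.inl d) * t := by
  have hle : ((SemidirectProduct.inr : Multiplicative ℤ →* Δ ⋊[φ] Multiplicative ℤ).range.map ι) ≤
      Subgroup.centralizer ({ι (SemidirectProduct.inl d)} : Set P) := by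
    rintro _ ⟨_, ⟨g, rfl⟩, rfl⟩
    rw [Subgroup.mem_centralizer_singleton_iff]
    have h := SemidirectProduct.inl_aut (φ := φ) g d
    rw [apply_eq_self_of_apply_one_eq_self φ hd] at h
    have h' := congrArg ι h
    simp only [map_mul, map_inv] at h'
    calc ι (SemidirectProduct.inr g) * ι (SemidirectProduct.inl d)
        = ι (SemidirectProduct.inr g) * ι (SemidirectProduct.inl d) * (ι (SemidirectProduct.inr g))⁻¹ *
            ι (SemidirectProduct.inr g) := by group
      _ = ι (SemidirectProduct.inl d) * ι (SemidirectProduct.inr g) := by rw [← h']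
  have hclosed : IsClosed ((Subgroup.centralizer ({ι (SemidirectProduct.inl d)} : Set P) : Subgroup P) : Set P) :=
    Set.isClosed_centralizer _
  have := (Subgroup.topologicalClosure_minimal _ hle hclosed) ht
  rw [Subgroup.mem_centralizer_singleton_iff] at this
  exact this

omit [CompactSpace P] [TotallyDisconnectedSpace P] in
/-- **The twisted section centralises the twisted letters**: if `φ(1) d = δ⁻¹ d δ` then every element of
`U = closure ι⟨inl δ · inr 1⟩` commutes with `ι(inl d)`. [cite: MochizukiAbsTopII2013, Prop 1.3 (iii) p.11] -/
theorem centralizes_twisted_of_conj (ι : (Δ ⋊[φ] Multiplicative ℤ) →* P) {δ d : Δ}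
    (hd : φ (Multiplicative.ofAdd (1 : ℤ)) d = δ⁻¹ * d * δ) {u : P}
    (hu : u ∈ (Subgroup.zpowers (ι (SemidirectProduct.inl δ *
      SemidirectProduct.inr (Multiplicative.ofAdd (1 : ℤ))))).topologicalClosure) :
    u * ι (SemidirectProduct.inl d) = ι (SemidirectProduct.inl d) * u := by
  have hcomm : (SemidirectProduct.inl δ * SemidirectProduct.inr (Multiplicative.ofAdd (1 : ℤ))) *
      SemidirectProduct.inl d * (SemidirectProduct.inl δ * SemidirectProduct.inr (Multiplicative.ofAdd (1 : ℤ)))⁻¹ =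
        (SemidirectProduct.inl d : Δ ⋊[φ] Multiplicative ℤ) := by
    have h := SemidirectProduct.inl_aut (φ := φ) (Multiplicative.ofAdd (1 : ℤ)) d
    simp only [hd, map_mul, map_inv] at h
    -- `inr 1 · inl d · inr 1⁻¹ = inl δ⁻¹ · inl d · inl δ`
    calc SemidirectProduct.inl δ * SemidirectProduct.inr (Multiplicative.ofAdd (1 : ℤ)) * SemidirectProduct.inl d *
          (SemidirectProduct.inl δ * SemidirectProduct.inr (Multiplicative.ofAdd (1 : ℤ)))⁻¹
        = SemidirectProduct.inl δ * (SemidirectProduct.inr (Multiplicative.ofAdd (1 : ℤ)) * SemidirectProduct.inl d *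
            (SemidirectProduct.inr (Multiplicative.ofAdd (1 : ℤ)))⁻¹) * (SemidirectProduct.inl δ)⁻¹ := by group
      _ = SemidirectProduct.inl δ * ((SemidirectProduct.inl δ)⁻¹ * SemidirectProduct.inl d * SemidirectProduct.inl δ) *
            (SemidirectProduct.inl δ)⁻¹ := by rw [← h]
      _ = SemidirectProduct.inl d := by group
  have hle : Subgroup.zpowers (ι (SemidirectProduct.inl δ * SemidirectProduct.inr (Multiplicative.ofAdd (1 : ℤ)))) ≤
      Subgroup.centralizer ({ι (SemidirectProduct.inl d)} : Set P) := by
    rw [Subgroup.zpowers_le, Subgroup.mem_centralizer_singleton_iff]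
    set a := ι (SemidirectProduct.inl δ * SemidirectProduct.inr (Multiplicative.ofAdd (1 : ℤ))) with ha
    have h' : a * ι (SemidirectProduct.inl d) * a⁻¹ = ι (SemidirectProduct.inl d) := by
      rw [ha, ← map_inv, ← map_mul, ← map_mul, hcomm]
    calc a * ι (SemidirectProduct.inl d) = a * ι (SemidirectProduct.inl d) * a⁻¹ * a := by group
      _ = ι (SemidirectProduct.inl d) * a := by rw [h']
  have hclosed : IsClosed ((Subgroup.centralizer ({ι (SemidirectProduct.inl d)} : Set P) : Subgroup P) : Set P) :=
    Set.isClosed_centralizer _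
  have := (Subgroup.topologicalClosure_minimal _ hle hclosed) hu
  rw [Subgroup.mem_centralizer_singleton_iff] at this
  exact this

/-! ### Two characters: `T` against the conjugates of a twisted section -/

/-- **`T ∩ γ U γ⁻¹ = {1}` and `U ∩ γ T γ⁻¹ = {1}` for every `γ ∈ P`**, for the twisted section
`U = closure ι⟨inl δ · inr 1⟩`, granted a `φ`-invariant character `f : Δ → ℤ` with `f δ = −1`: the continuous
extension `G : P → T` of `inl d ↦ f d`, `inr n ↦ n` kills `u = inl δ · inr 1`, hence `U` and — `T` being abelian —
all its conjugates, while `G|_T = id` («In particular, `I_v ∩ I_{v′} ≠ {1}` implies `v = v′`», for all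
conjugates, at the model). [cite: MochizukiAbsTopII2013, Prop 1.3 (iv) p.11] -/
theorem closure_inr_inf_conj_closure_zpowers_eq_bot {ι : (Δ ⋊[φ] Multiplicative ℤ) →* P}
    (hι : IsProSigmaCompletion Sigma ι) (f : Δ →* Multiplicative ℤ) (hf : ∀ (g : Multiplicative ℤ) (x : Δ), f (φ g x) = f x)
    (δ : Δ) (hδ : f δ = (Multiplicative.ofAdd (1 : ℤ))⁻¹) (γ : P) :
    ((SemidirectProduct.inr : Multiplicative ℤ →* Δ ⋊[φ] Multiplicative ℤ).range.map ι).topologicalClosure ⊓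
        MulAut.conj γ • (Subgroup.zpowers (ι (SemidirectProduct.inl δ *
          SemidirectProduct.inr (Multiplicative.ofAdd (1 : ℤ))))).topologicalClosure = ⊥ ∧
      (Subgroup.zpowers (ι (SemidirectProduct.inl δ *
          SemidirectProduct.inr (Multiplicative.ofAdd (1 : ℤ))))).topologicalClosure ⊓
        MulAut.conj γ • ((SemidirectProduct.inr :
          Multiplicative ℤ →* Δ ⋊[φ] Multiplicative ℤ).range.map ι).topologicalClosure = ⊥ := by
  set T := ((SemidirectProduct.inr : Multiplicative ℤ →* Δ ⋊[φ] Multiplicative ℤ).range.map ι).topologicalClosure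
    with hT
  set U := (Subgroup.zpowers (ι (SemidirectProduct.inl δ * SemidirectProduct.inr (Multiplicative.ofAdd (1 : ℤ))))).topologicalClosure
    with hU
  haveI : CompactSpace T := isCompact_iff_compactSpace.mp (Subgroup.isClosed_topologicalClosure _).isCompact
  set κ : Multiplicative ℤ →* T :=
    ((Subgroup.inclusion (Subgroup.le_topologicalClosure
      ((SemidirectProduct.inr : Multiplicative ℤ →* Δ ⋊[φ] Multiplicative ℤ).range.map ι))).comp
      (ι.subgroupMap (SemidirectProduct.inr : Multiplicative ℤ →* Δ ⋊[φ] Multiplicative ℤ).range)).comp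
      (MonoidHom.ofInjective (SemidirectProduct.inr_injective (φ := φ))).toMonoidHom with hκ_def
  have hκ : IsProSigmaCompletion Sigma κ := isProSigmaCompletion_closure_inr φ hι
  have hκv : ∀ n, (κ n : P) = ι (SemidirectProduct.inr n) := fun n => rfl
  have hTcomm : ∀ x y : T, x * y = y * x := mul_comm_of_denseRange κ hκ.dense
  -- the character `inl d ↦ f d`, `inr n ↦ n` of `Δ ⋊ ℤ`
  let g₀ : (Δ ⋊[φ] Multiplicative ℤ) →* Multiplicative ℤ :=
    SemidirectProduct.lift f (MonoidHom.id _) fun g => by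
      ext x
      simp only [MonoidHom.comp_apply, MulEquiv.coe_toMonoidHom, MulAut.conj_apply, MonoidHom.id_apply,
        mul_inv_cancel_comm, hf]
  have hg₀u : g₀ (SemidirectProduct.inl δ * SemidirectProduct.inr (Multiplicative.ofAdd (1 : ℤ))) = 1 := by
    rw [map_mul, SemidirectProduct.lift_inl, SemidirectProduct.lift_inr, hδ, MonoidHom.id_apply, inv_mul_cancel]
  obtain ⟨G, hGc, hGι⟩ := exists_continuous_extend_profinite hι hκ.index_open (κ.comp g₀)
  -- `G|_T = id`
  have hGT : ∀ (t : P) (ht : t ∈ T), (G t : P) = t := by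
    intro t ht
    have h := continuous_extend_profinite_unique hκ (F := G.comp T.subtype) (F' := MonoidHom.id T)
      (hGc.comp continuous_subtype_val) continuous_id fun n => by
        rw [MonoidHom.comp_apply, MonoidHom.id_apply, Subgroup.coe_subtype, hκv, hGι, MonoidHom.comp_apply,
          SemidirectProduct.lift_inr, MonoidHom.id_apply]
    have := DFunLike.congr_fun h ⟨t, ht⟩
    rw [MonoidHom.comp_apply, MonoidHom.id_apply, Subgroup.coe_subtype] at this
    rw [this]
  -- `G` kills every conjugate of `U`
  have hGU : ∀ (γ' x : P), x ∈ MulAut.conj γ' • U → G x = 1 := by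
    intro γ' x hx
    obtain ⟨u, hu, rfl⟩ := (Subgroup.mem_smul_pointwise_iff_exists _ _ _).mp hx
    rw [MulAut.smul_def, MulAut.conj_apply, map_mul, map_mul, map_inv, hTcomm (G γ') (G u), mul_assoc,
      mul_inv_cancel, mul_one]
    have hker : IsClosed (G.ker : Set P) := by
      rw [MonoidHom.coe_ker]; exact isClosed_singleton.preimage hGc
    have hle : Subgroup.zpowers (ι (SemidirectProduct.inl δ * SemidirectProduct.inr (Multiplicative.ofAdd (1 : ℤ)))) ≤ G.ker := by
      rw [Subgroup.zpowers_le, MonoidHom.mem_ker, hGι, MonoidHom.comp_apply, hg₀u, map_one]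
    exact (Subgroup.topologicalClosure_minimal _ hle hker) hu
  constructor
  · rw [eq_bot_iff]
    rintro x ⟨hxT, hxU⟩
    rw [Subgroup.mem_bot, ← hGT x hxT, hGU γ x hxU, Subgroup.coe_one]
  · rw [eq_bot_iff]
    rintro x ⟨hxU, hxT⟩
    rw [Subgroup.mem_bot]
    obtain ⟨t, ht, rfl⟩ := (Subgroup.mem_smul_pointwise_iff_exists _ _ _).mp hxT
    have hx1 : G (MulAut.conj γ • t) = 1 := hGU 1 _ (by rwa [map_one, one_smul])
    rw [MulAut.smul_def, MulAut.conj_apply, map_mul, map_mul, map_inv, hTcomm (G γ) (G t), mul_assoc,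
      mul_inv_cancel, mul_one] at hx1
    have ht1 : t = 1 := by rw [← hGT t ht, hx1, Subgroup.coe_one]
    rw [MulAut.smul_def, MulAut.conj_apply, ht1, mul_one, mul_inv_cancel]

end SemidirectCofinal

end Literature.AnabelianGeometry.SemiGraphs.SemiGraphOfAnabelioids.IsProSigmaCompletion
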